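import Mathlib
import Literature.MathematicalPhysics.QuantumFieldTheory.Balaban1983to89.Beta.DeltaACombesThomas
import Literature.MathematicalPhysics.QuantumFieldTheory.Balaban1983to89.Beta.TorusG0Decay
import Literature.MathematicalPhysics.QuantumFieldTheory.Balaban1983to89.Beta.CombesThomasKernelTail

/-!
# Set-to-set and entry decay of `𝒢(a) = Δ_a⁻¹` in block units, modulo (1.126) — the
distance-to-the-source weight for `Beta/DeltaACombesThomas`

HONEST FRAMING (page 1).  This file belongs to the β sub-cell of the Bałaban YM₄ cell.  The
cell's target is the ONE-LOOP coupling-flow hypothesis `BetaPertH` of B12/B16; discharging it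
would make Bałaban's ULTRAVIOLET STABILITY theorem unconditional — NOT the continuum limit, NOT
the Clay Millennium problem (axioms (c) and (d) stay open).  This module does not touch
`BetaPertH` at all: it is free-side KERNEL depth (propagator decay), an optional input toward the
α-leaf `B5.Prop12Printed` of the wall certificate, and it is CONDITIONAL on a (1.126)-type bound
`hP` which is NOT proved here.

WHAT THIS FILE DOES.  `Beta/DeltaACombesThomas` (v1, p188106) proves the L²-form Combes–Thomas
bound `calG_form_decay_of_pieces` for the B5 vector operator `Δ_a = Δ − ∂P∂* + aQ_k*Q_k`
[Balaban1984PropagatorsI, (1.69) p.29] under FOUR hypotheses on an abstract weight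
`ρ : T_η × {1..d} → ℝ`: (hℓ) `1/n`-Lipschitz along fine bonds, (hL) oscillation `≤ L` on the
extended block stencils of `Q_k`, (hP) a bound `J_P` on the row defect of `∂P∂*`, (hm) smallness.
Here we remove (hL) and the abstractness of `ρ`:
* §1 (hℓ) ⇒ (hL) with `L = 2(d+1)·n·ℓ` (`stencil_osc_of_lipschitz`): every stencil point
  `ny + j + te_μ` is joined to the block corner `ny` by straight contours of `≤ (d+1)(n−1)` fine
  bonds (`lipschitz_tstep`, `lipschitz_sum_tstep`, `iota_eq_sum_tstep`);
* §2 the distance-to-the-source weight `ρ_T(x, μ) = c·dist_∞(x, T)` (`rhoT`) built on the torus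
  sup distance `TorusG0Decay.ldist` and `CombesThomasFormOp.distTo` of the an2/pv23
  Combes–Thomas chain: `|c|`-Lipschitz along fine bonds (`rhoT_lipschitz`, from
  `ldist_step_le`), `≤ 0` on the source, `≥ c·r` at distance `≥ r` (`rhoT_le_zero_of_mem`,
  `le_rhoT`);
* §3 the deliverables needing ONLY `hP` and the smallness: `calG_setDecay` — for `v` supported on
  `T × {1..d}` and `u` supported at sup distance `≥ nR` (= `R` blocks) from `T`,
  `|⟨u, 𝒢(a)v⟩| ≤ e^{−κR}/(γ(d,a) − dκ²e^{κ²/2} − |a|(cosh(2(d+1)κ) − 1) − J_P)·‖u‖‖v‖`; and the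
  entry bound `calG_entry_decay` (`T = {x′}`): `|𝒢(a)((x,μ),(x′,ν))| ≤` the same constant when
  `dist_∞(x,x′) ≥ nR`.  All constants are free of `n = L^k` and of the torus `M`; the one size
  hypothesis `2 ≤ nM_μ` only excludes one-point torus directions;
* §4 rate scaling (`ctRowDefect_le_rate_sq`, termwise `CombesThomasKernelTail.cosh_sub_one_le_rate`
  of the pv23 chain): ONE exponential moment `m` of `∂P∂*` at a reference rate `κ₀` bounds `J_P`
  by `(κ/κ₀)²m` at every `κ ≤ κ₀` — second order in `κ`, so the smallness is met by SOME `κ > 0`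
  whatever the size of `m` (`exists_rate`, continuity at `κ = 0`);
* §5 the UNIFORM statement `calG_setDecay_uniform`: `∃ κ ∈ (0, κ₀]` quantified BEFORE `n`, `M`,
  `T`, `u`, `v` — i.e. depending on `(d, a, κ₀, m)` only — with
  `|⟨u, 𝒢(a)v⟩| ≤ (2/γ(d,a))·e^{−κR}·‖u‖‖v‖` whenever the `κ₀`-moment of `∂P∂*` for `ρ_T` is
  `≤ m`: the quantifier shape of the printed «δ₀ > 0 depending on d only», in L²-form, with the
  (1.126)-type moment as the ONLY input.

WHAT IT IS NOT.  Not (1.126) (the bound `J_P` on the `∂P∂*` row defect for the weight `ρ_T` is a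
HYPOTHESIS, a free real number — by the ABSOLUTE RULE no printed statement is used as a
hypothesis-fact); not the printed sup-norm / Hölder statements (1.110)–(1.114) of Prop. 1.2 (these
are L²-form and matrix-entry shadows in the `mulVec` normalisation of `B5DeltaA169.calG`, with no
short-distance singular factor claimed); not `U ≠ 1`; nothing about β, the continuum limit or Clay.
The Combes–Thomas MECHANISM is the an2/pv23 chain's (`Beta/CombesThomasForm|FormOp|Kernel|
KernelTail`, `TorusG0*`); no novelty of method is claimed — the distance weight is literally the
chain's `distTo ∘ ldist`.

References: [Balaban1984PropagatorsI] T. Bałaban, Propagators and renormalization transformations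
for lattice gauge theories. I, Comm. Math. Phys. 95 (1984) 17–40 — (1.6) p.18 (blocks
`B(y) = {x : y_μ ≤ x_μ < y_μ + 1}`), (1.18) p.20 (`Q_k`), (1.69) p.29, Prop. 1.2 (1.110) p.35,
(1.126) p.38 (text locations of objects only).
-/

namespace Literature.MathematicalPhysics.QuantumFieldTheory.Balaban1983to89.Beta.DeltaACombesThomasSets

open Matrix
open Literature.MathematicalPhysics.QuantumFieldTheory.Balaban1983to89.Beta.DeltaACombesThomas

/-! ## §1 The stencil oscillation follows from the fine-bond Lipschitz property -/

section Sets

open Literature.MathematicalPhysics.QuantumFieldTheory.Balaban1983to89.B5Prop11Plancherel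
open Literature.MathematicalPhysics.QuantumFieldTheory.Balaban1983to89.B5Prop11Inverse
open Literature.MathematicalPhysics.QuantumFieldTheory.Balaban1983to89.B5Prop11Lower
open Literature.MathematicalPhysics.QuantumFieldTheory.Balaban1983to89.B5DeltaA169
open Literature.MathematicalPhysics.QuantumFieldTheory.Balaban1983to89.B5Action121 (GradOp)
open Literature.MathematicalPhysics.QuantumFieldTheory.Balaban1983to89.B5Value126 (PcT)
open Literature.MathematicalPhysics.QuantumFieldTheory.Balaban1983to89.B5Block118
  (QvOp bpt tstep tstep_zero tstep_succ up iota)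
open Literature.MathematicalPhysics.QuantumFieldTheory.Balaban1983to89.Beta.TorusG0Decay
  (ldist ldist_self ldist_symm ldist_triangle ldist_step_le)
open Literature.MathematicalPhysics.QuantumFieldTheory.Balaban1983to89.Beta.CombesThomasFormOp
  (distTo distTo_le le_distTo distTo_le_zero_of_mem abs_distTo_sub_le)

variable {d : ℕ} (N : Fin d → ℕ) [hN : ∀ μ, NeZero (N μ)]

omit hN in
/-- Lipschitz along fine bonds propagates along straight contours: `|ρ(x + te_ν) − ρ(x)| ≤ tℓ`.
[folklore] -/
theorem lipschitz_tstep (ρ : Tor N × Fin d → ℝ) {ℓ : ℝ}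
    (hℓ : ∀ (x : Tor N) (μ : Fin d) (ν : Fin d), |ρ (x + unitVec N ν, μ) - ρ (x, μ)| ≤ ℓ)
    (x : Tor N) (μ ν : Fin d) (t : ℕ) :
    |ρ (x + tstep N ν t, μ) - ρ (x, μ)| ≤ t * ℓ := by
  induction t with
  | zero => simp [tstep_zero]
  | succ t ih =>
    rw [tstep_succ, ← add_assoc]
    calc |ρ (x + tstep N ν t + unitVec N ν, μ) - ρ (x, μ)|
        ≤ |ρ (x + tstep N ν t + unitVec N ν, μ) - ρ (x + tstep N ν t, μ)|
            + |ρ (x + tstep N ν t, μ) - ρ (x, μ)| := abs_sub_le _ _ _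
      _ ≤ ℓ + t * ℓ := add_le_add (hℓ _ μ ν) ih
      _ = ((t + 1 : ℕ) : ℝ) * ℓ := by push_cast; ring

omit hN in
/-- … and along sums of straight contours: `|ρ(x + Σ_{ν∈s} m_ν e_ν) − ρ(x)| ≤ (Σ_{ν∈s} m_ν)ℓ`.
[folklore] -/
theorem lipschitz_sum_tstep (ρ : Tor N × Fin d → ℝ) {ℓ : ℝ}
    (hℓ : ∀ (x : Tor N) (μ : Fin d) (ν : Fin d), |ρ (x + unitVec N ν, μ) - ρ (x, μ)| ≤ ℓ)
    (x : Tor N) (μ : Fin d) (m : Fin d → ℕ) (s : Finset (Fin d)) :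
    |ρ (x + ∑ ν ∈ s, tstep N ν (m ν), μ) - ρ (x, μ)| ≤ (∑ ν ∈ s, (m ν : ℝ)) * ℓ := by
  induction s using Finset.induction_on with
  | empty => simp
  | insert ν s hν ih =>
    rw [Finset.sum_insert hν, Finset.sum_insert hν, add_comm (tstep N ν (m ν)), ← add_assoc]
    calc |ρ (x + ∑ ν ∈ s, tstep N ν (m ν) + tstep N ν (m ν), μ) - ρ (x, μ)|
        ≤ |ρ (x + ∑ ν ∈ s, tstep N ν (m ν) + tstep N ν (m ν), μ)
              - ρ (x + ∑ ν ∈ s, tstep N ν (m ν), μ)|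
            + |ρ (x + ∑ ν ∈ s, tstep N ν (m ν), μ) - ρ (x, μ)| := abs_sub_le _ _ _
      _ ≤ (m ν : ℝ) * ℓ + (∑ ν ∈ s, (m ν : ℝ)) * ℓ :=
          add_le_add (lipschitz_tstep N ρ hℓ _ μ ν (m ν)) ih
      _ = ((m ν : ℝ) + ∑ ν ∈ s, (m ν : ℝ)) * ℓ := by ring

variable {N}
variable (n : ℕ) [NeZero n] (M : Fin d → ℕ) [hM : ∀ μ, NeZero (M μ)]

omit [NeZero n] hM in
/-- the in-block offset is a sum of straight contours: `ι(j) = Σ_ν j_ν e_ν`.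
[cite: Balaban1984PropagatorsI, (1.6) p.18] -/
theorem iota_eq_sum_tstep (j : Fin d → Fin n) :
    iota n M j = ∑ ν : Fin d, tstep (fine n M) ν (j ν : ℕ) := by
  funext ν'
  rw [Finset.sum_apply]
  simp [iota, tstep]

omit [NeZero n] hM in
/-- **Stencil oscillation from the Lipschitz property.**  If `ρ` is `ℓ`-Lipschitz along fine
bonds, it oscillates by at most `2(d+1)·n·ℓ` over each extended block stencil
`{(ny + j + te_μ, μ)}` (`j ∈ {0..n−1}^d`, `0 ≤ t < n`): both points are joined to `(ny, μ)` by
straight contours of at most `(d+1)(n−1)` fine bonds. [folklore] -/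
theorem stencil_osc_of_lipschitz (ρ : Tor (fine n M) × Fin d → ℝ) {ℓ : ℝ} (hℓ0 : 0 ≤ ℓ)
    (hℓ : ∀ (x : Tor (fine n M)) (μ : Fin d) (ν : Fin d),
      |ρ (x + unitVec (fine n M) ν, μ) - ρ (x, μ)| ≤ ℓ)
    (y : Tor M) (μ : Fin d) (j j' : Fin d → Fin n) (t t' : Fin n) :
    |ρ (bpt n M y j + tstep (fine n M) μ t, μ) - ρ (bpt n M y j' + tstep (fine n M) μ t', μ)|
      ≤ 2 * (((d : ℝ) + 1) * n) * ℓ := by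
  -- one stencil point against the block corner `ny`
  have one : ∀ (j : Fin d → Fin n) (t : Fin n),
      |ρ (bpt n M y j + tstep (fine n M) μ t, μ) - ρ (up n M y, μ)| ≤ (((d : ℝ) + 1) * n) * ℓ := by
    intro j t
    have hA := lipschitz_sum_tstep (fine n M) ρ hℓ (up n M y) μ (fun ν => (j ν : ℕ)) Finset.univ
    have hB := lipschitz_tstep (fine n M) ρ hℓ (up n M y + iota n M j) μ μ (t : ℕ)
    rw [← iota_eq_sum_tstep n M j] at hA
    have hbpt : bpt n M y j = up n M y + iota n M j := rfl
    rw [hbpt]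
    have hsumj : (∑ ν : Fin d, ((j ν : ℕ) : ℝ)) ≤ (d : ℝ) * n := by
      calc (∑ ν : Fin d, ((j ν : ℕ) : ℝ)) ≤ ∑ _ν : Fin d, (n : ℝ) :=
            Finset.sum_le_sum fun ν _ => by exact_mod_cast (j ν).is_lt.le
        _ = (d : ℝ) * n := by
            rw [Finset.sum_const, Finset.card_univ, Fintype.card_fin, nsmul_eq_mul]
    have ht : ((t : ℕ) : ℝ) ≤ n := by exact_mod_cast t.is_lt.le
    calc |ρ (up n M y + iota n M j + tstep (fine n M) μ t, μ) - ρ (up n M y, μ)|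
        ≤ |ρ (up n M y + iota n M j + tstep (fine n M) μ t, μ) - ρ (up n M y + iota n M j, μ)|
            + |ρ (up n M y + iota n M j, μ) - ρ (up n M y, μ)| := abs_sub_le _ _ _
      _ ≤ (t : ℕ) * ℓ + (∑ ν : Fin d, ((j ν : ℕ) : ℝ)) * ℓ := add_le_add hB hA
      _ ≤ n * ℓ + (d : ℝ) * n * ℓ :=
          add_le_add (mul_le_mul_of_nonneg_right ht hℓ0) (mul_le_mul_of_nonneg_right hsumj hℓ0)
      _ = (((d : ℝ) + 1) * n) * ℓ := by ring
  calc |ρ (bpt n M y j + tstep (fine n M) μ t, μ) - ρ (bpt n M y j' + tstep (fine n M) μ t', μ)|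
      ≤ |ρ (bpt n M y j + tstep (fine n M) μ t, μ) - ρ (up n M y, μ)|
          + |ρ (up n M y, μ) - ρ (bpt n M y j' + tstep (fine n M) μ t', μ)| := abs_sub_le _ _ _
    _ ≤ (((d : ℝ) + 1) * n) * ℓ + (((d : ℝ) + 1) * n) * ℓ := by
        refine add_le_add (one j t) ?_
        rw [abs_sub_comm]; exact one j' t'
    _ = 2 * (((d : ℝ) + 1) * n) * ℓ := by ring

/-! ## §2 The distance-to-the-source weight on `TorusG0Decay.ldist` -/

/-- the DISTANCE-TO-THE-SOURCE weight in block units: `ρ_T(x, μ) = c · dist_∞(x, T)` with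
`dist_∞ = TorusG0Decay.ldist` (the torus sup distance in fine lattice units) and
`distTo = CombesThomasFormOp.distTo`; the consumer takes `c = η = 1/n`. [folklore] -/
def rhoT (T : Finset (Tor N)) (hT : T.Nonempty) (c : ℝ) (e : Tor N × Fin d) : ℝ :=
  c * distTo (ldist N) T hT e.1

/-- `ρ_T` is `|c|`-Lipschitz along fine bonds (a bond has `ldist ≤ 1`). [folklore] -/
theorem rhoT_lipschitz (h2 : ∀ μ, 2 ≤ N μ) (T : Finset (Tor N)) (hT : T.Nonempty) (c : ℝ)
    (x : Tor N) (μ ν : Fin d) :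
    |rhoT T hT c (x + unitVec N ν, μ) - rhoT T hT c (x, μ)| ≤ |c| := by
  rw [rhoT, rhoT, ← mul_sub, abs_mul]
  refine mul_le_of_le_one_right (abs_nonneg c) ?_
  have h := abs_distTo_sub_le (ldist N) (ldist_symm N) (ldist_triangle N) T hT (x + unitVec N ν) x
  have h1 : ldist N (x + unitVec N ν) x ≤ 1 := by exact_mod_cast ldist_step_le N h2 x ν
  exact h.trans h1

/-- `ρ_T ≤ 0` on the source: `T × {1..d}`. [folklore] -/
theorem rhoT_le_zero_of_mem (T : Finset (Tor N)) (hT : T.Nonempty) {c : ℝ} (hc : 0 ≤ c)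
    {e : Tor N × Fin d} (he : e.1 ∈ T) : rhoT T hT c e ≤ 0 :=
  mul_nonpos_iff.mpr (Or.inl ⟨hc, distTo_le_zero_of_mem (ldist N) (ldist_self N) T hT he⟩)

/-- `ρ_T ≥ c·r` wherever every source point is at `ldist ≥ r`. [folklore] -/
theorem le_rhoT (T : Finset (Tor N)) (hT : T.Nonempty) {c : ℝ} (hc : 0 ≤ c) {e : Tor N × Fin d}
    {r : ℝ} (hr : ∀ t ∈ T, r ≤ ldist N e.1 t) : c * r ≤ rhoT T hT c e :=
  mul_le_mul_of_nonneg_left (le_distTo (ldist N) T hT hr) hc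

/-! ## §3 Set-to-set and entry decay of `𝒢(a)` modulo (1.126) -/

variable (hn : 1 ≤ n) (a : ℝ) (ha : 0 < a)

/-- **Set-to-set L²-form decay of `𝒢(a) = Δ_a⁻¹` in block units, modulo (1.126).**  For a
nonempty set `T` of fine sites, `v` supported on `T × {1..d}`, `u` supported on sites at sup
distance `≥ nR` (i.e. `≥ R` blocks) from `T`, and ANY bound `J_P` on the row defect of `∂P∂*`
for the weight `ρ_T = η·dist_∞(·, T)`: if `dκ²e^{κ²/2} + |a|(cosh(2(d+1)κ) − 1) + J_P < γ(d,a)`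
then `|⟨u, 𝒢(a)v⟩| ≤ e^{−κR}/(γ(d,a) − dκ²e^{κ²/2} − |a|(cosh(2(d+1)κ) − 1) − J_P)·‖u‖‖v‖` —
constants free of `n = L^k` and of the torus (the one size hypothesis `2 ≤ nM_μ` excludes the
one-point torus directions, where `ldist_step_le` is not available by name).  This is the L²-form
shadow of the off-diagonal decay «O(1)e^{−δ₀|y−y′|}» of Prop. 1.2 with `δ₀ ↔ κ`, for the
propagator `G` itself, CONDITIONAL on the (1.126)-type input `hP` only.
[cite: Balaban1984PropagatorsI, Prop. 1.2 (1.110)/(1.114) pp.35–36 (L²-form shadow; proof by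
the Combes–Thomas method, ours, not the printed (1.128)–(1.131))] -/
theorem calG_setDecay (h2 : ∀ μ, 2 ≤ fine n M μ) (T : Finset (Tor (fine n M))) (hT : T.Nonempty)
    {κ JP R : ℝ} (hκ : 0 ≤ κ)
    (hP : ∀ e, ctRowDefect
      (GradOp (fine n M) (n : ℂ) * PcT n M (n : ℂ) * (GradOp (fine n M) (n : ℂ))ᴴ) κ
        (rhoT T hT (1 / n)) e ≤ JP)
    (hm : defectBudget d a κ (2 * ((d : ℝ) + 1)) + JP < gammaA d a)
    {u v : Tor (fine n M) × Fin d → ℂ}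
    (hv : ∀ e, v e ≠ 0 → e.1 ∈ T)
    (hu : ∀ e, u e ≠ 0 → ∀ t ∈ T, (n : ℝ) * R ≤ ldist (fine n M) e.1 t) :
    ‖star u ⬝ᵥ (calG n hn M a ha *ᵥ v)‖
      ≤ Real.exp (-(κ * R)) / (gammaA d a - (defectBudget d a κ (2 * ((d : ℝ) + 1)) + JP))
          * (Real.sqrt (nsq u) * Real.sqrt (nsq v)) := by
  have hn0 : (0 : ℝ) < n := by exact_mod_cast hn
  have hc : (0 : ℝ) ≤ 1 / n := by positivity
  -- the weight is `1/n`-Lipschitz along fine bonds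
  have hℓ : ∀ (x : Tor (fine n M)) (μ : Fin d) (ν : Fin d),
      |rhoT T hT (1 / n) (x + unitVec (fine n M) ν, μ) - rhoT T hT (1 / n) (x, μ)| ≤ 1 / n := by
    intro x μ ν
    have h := rhoT_lipschitz h2 T hT (1 / n) x μ ν
    rwa [abs_of_nonneg hc] at h
  -- hence it oscillates by ≤ 2(d+1) on the stencils
  have hL : ∀ (y : Tor M) (μ : Fin d) (j j' : Fin d → Fin n) (t t' : Fin n),
      |rhoT T hT (1 / n) (bpt n M y j + tstep (fine n M) μ t, μ)
        - rhoT T hT (1 / n) (bpt n M y j' + tstep (fine n M) μ t', μ)| ≤ 2 * ((d : ℝ) + 1) := by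
    intro y μ j j' t t'
    have h := stencil_osc_of_lipschitz n M (rhoT T hT (1 / n)) hc hℓ y μ j j' t t'
    have heq : 2 * (((d : ℝ) + 1) * n) * (1 / n) = 2 * ((d : ℝ) + 1) := by
      field_simp
    rwa [heq] at h
  refine calG_form_decay_of_pieces n hn M a ha (rhoT T hT (1 / n)) hκ hℓ hL hP hm ?_ ?_
  · intro e he
    have h := le_rhoT T hT hc (hu e he)
    have heq : 1 / (n : ℝ) * (n * R) = R := by field_simp
    rwa [heq] at h
  · intro e he
    exact rhoT_le_zero_of_mem T hT hc (hv e he)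

/-- **Entry decay of `𝒢(a)` in block units, modulo (1.126)** (the case `T = {x′}`, `u = δ_e`,
`v = δ_{e′}` of `calG_setDecay`): if `dist_∞(x, x′) ≥ nR` then
`|𝒢(a)((x,μ),(x′,ν))| ≤ e^{−κR}/(γ(d,a) − dκ²e^{κ²/2} − |a|(cosh(2(d+1)κ) − 1) − J_P)` — the
matrix entries in the `mulVec` normalisation of `B5DeltaA169.calG`; an L²-form shadow of the
printed kernel bound (1.110) `|G(a)(x,x′)| ≤ O(1)|x−x′|^{−d+2}e^{−δ₀|x−x′|}` away from the
diagonal (no short-distance singularity is claimed or needed at the level of entries).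
[cite: Balaban1984PropagatorsI, Prop. 1.2 (1.110) p.35 (shadow, ours)] -/
theorem calG_entry_decay (h2 : ∀ μ, 2 ≤ fine n M μ) (e e' : Tor (fine n M) × Fin d)
    {κ JP R : ℝ} (hκ : 0 ≤ κ)
    (hP : ∀ x, ctRowDefect
      (GradOp (fine n M) (n : ℂ) * PcT n M (n : ℂ) * (GradOp (fine n M) (n : ℂ))ᴴ) κ
        (rhoT {e'.1} (Finset.singleton_nonempty _) (1 / n)) x ≤ JP)
    (hm : defectBudget d a κ (2 * ((d : ℝ) + 1)) + JP < gammaA d a)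
    (hR : (n : ℝ) * R ≤ ldist (fine n M) e.1 e'.1) :
    ‖calG n hn M a ha e e'‖
      ≤ Real.exp (-(κ * R)) / (gammaA d a - (defectBudget d a κ (2 * ((d : ℝ) + 1)) + JP)) := by
  have h := calG_setDecay n M hn a ha h2 {e'.1} (Finset.singleton_nonempty _) hκ hP hm
    (u := (Pi.single e 1 : Tor (fine n M) × Fin d → ℂ))
    (v := (Pi.single e' 1 : Tor (fine n M) × Fin d → ℂ))
    (fun x hx => by
      have hxe : x = e' := by
        by_contra hne
        exact hx (by simp [hne])
      simp [hxe])
    (fun x hx t ht => by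
      have hxe : x = e := by
        by_contra hne
        exact hx (by simp [hne])
      rw [Finset.mem_singleton] at ht
      rw [hxe, ht]; exact hR)
  have h1 : star (Pi.single e 1 : Tor (fine n M) × Fin d → ℂ)
        ⬝ᵥ (calG n hn M a ha *ᵥ (Pi.single e' 1 : Tor (fine n M) × Fin d → ℂ))
      = calG n hn M a ha e e' := by
    have hs : star (Pi.single e 1 : Tor (fine n M) × Fin d → ℂ) = Pi.single e 1 := by
      ext x
      by_cases hx : x = e
      · subst hx; simp
      · simp [hx]
    rw [hs]
    simp [dotProduct, Matrix.mulVec, Pi.single_apply]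
  have h2' : nsq (Pi.single e 1 : Tor (fine n M) × Fin d → ℂ) = 1 := by
    simp [nsq, Pi.single_apply, apply_ite]
  have h3 : nsq (Pi.single e' 1 : Tor (fine n M) × Fin d → ℂ) = 1 := by
    simp [nsq, Pi.single_apply, apply_ite]
  rw [h1, h2', h3, Real.sqrt_one, mul_one, mul_one] at h
  exact h

end Sets

/-! ## §4 Rate scaling of the row defect (second order): ONE exponential moment of `∂P∂*` at a
reference rate `κ₀` bounds `J_P` by `(κ/κ₀)²·m` at every rate `κ ≤ κ₀`
(`CombesThomasKernelTail.cosh_sub_one_le_rate`, pv23) -/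

section Rate

open Literature.MathematicalPhysics.QuantumFieldTheory.Balaban1983to89.Beta.CombesThomasKernelTail
  (cosh_sub_one_le_rate)

variable {ι : Type*} [Fintype ι]

/-- `defect_κ(A, ρ) ≤ (κ/κ₀)²·defect_{κ₀}(A, ρ)` for `0 ≤ κ ≤ κ₀` (termwise
`cosh(κs) − 1 ≤ (κ/κ₀)²(cosh(κ₀s) − 1)`). [folklore] -/
theorem ctRowDefect_le_rate_sq (A : Matrix ι ι ℂ) (ρ : ι → ℝ) {κ κ₀ : ℝ} (hκ₀ : 0 < κ₀)
    (hκ : 0 ≤ κ) (hle : κ ≤ κ₀) (e : ι) :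
    ctRowDefect A κ ρ e ≤ (κ / κ₀) ^ 2 * ctRowDefect A κ₀ ρ e := by
  unfold ctRowDefect ctWeight
  rw [Finset.mul_sum]
  refine Finset.sum_le_sum fun e' _ => ?_
  have hw := cosh_sub_one_le_rate hκ₀ hκ hle (ρ e - ρ e')
  calc ‖A e e'‖ * (Real.cosh (κ * (ρ e - ρ e')) - 1)
      ≤ ‖A e e'‖ * ((κ / κ₀) ^ 2 * (Real.cosh (κ₀ * (ρ e - ρ e')) - 1)) :=
        mul_le_mul_of_nonneg_left hw (norm_nonneg _)
    _ = (κ / κ₀) ^ 2 * (‖A e e'‖ * (Real.cosh (κ₀ * (ρ e - ρ e')) - 1)) := by ring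

end Rate

/-! ## §5 A UNIFORM rate: `∃ κ > 0` depending on `(d, a, κ₀, m)` only — quantified BEFORE the
lattice `n = L^k`, the torus `M`, the source set and the test vectors -/

section Uniform

open Literature.MathematicalPhysics.QuantumFieldTheory.Balaban1983to89.B5Prop11Plancherel
open Literature.MathematicalPhysics.QuantumFieldTheory.Balaban1983to89.B5Prop11Inverse
open Literature.MathematicalPhysics.QuantumFieldTheory.Balaban1983to89.B5Prop11Lower
open Literature.MathematicalPhysics.QuantumFieldTheory.Balaban1983to89.B5DeltaA169
open Literature.MathematicalPhysics.QuantumFieldTheory.Balaban1983to89.B5Action121 (GradOp)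
open Literature.MathematicalPhysics.QuantumFieldTheory.Balaban1983to89.B5Value126 (PcT)
open Literature.MathematicalPhysics.QuantumFieldTheory.Balaban1983to89.Beta.TorusG0Decay (ldist)

/-- the smallness budget can be met by a positive rate: for `κ₀ > 0`, `m ≥ 0` there is
`κ ∈ (0, κ₀]` with `dκ²e^{κ²/2} + |a|(cosh(2(d+1)κ) − 1) + (κ/κ₀)²m ≤ γ(d,a)/2` (continuity at
`κ = 0`, where the budget vanishes). [folklore] -/
theorem exists_rate (d : ℕ) (a : ℝ) {κ₀ : ℝ} (hκ₀ : 0 < κ₀) (m : ℝ) :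
    ∃ κ : ℝ, 0 < κ ∧ κ ≤ κ₀ ∧
      defectBudget d a κ (2 * ((d : ℝ) + 1)) + (κ / κ₀) ^ 2 * m ≤ gammaA d a / 2 := by
  set B : ℝ → ℝ := fun κ => defectBudget d a κ (2 * ((d : ℝ) + 1)) + (κ / κ₀) ^ 2 * m with hB
  have hcont : Continuous B := by
    simp only [hB, defectBudget]
    fun_prop
  have hB0 : B 0 < gammaA d a / 2 := by
    have hγ := gammaA_pos (d := d) (a := a)
    simp only [hB, defectBudget_zero, zero_div, ne_eq, OfNat.ofNat_ne_zero, not_false_eq_true,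
      zero_pow, zero_mul, add_zero]
    linarith
  have hev : ∀ᶠ κ in nhds (0 : ℝ), B κ < gammaA d a / 2 :=
    hcont.continuousAt.eventually_lt continuousAt_const hB0
  obtain ⟨ε, hε, hball⟩ := Metric.eventually_nhds_iff.mp hev
  refine ⟨min κ₀ (ε / 2), lt_min hκ₀ (by linarith), min_le_left _ _, ?_⟩
  have hd : dist (min κ₀ (ε / 2)) 0 < ε := by
    rw [Real.dist_eq, sub_zero, abs_of_pos (lt_min hκ₀ (by linarith))]
    exact (min_le_right _ _).trans_lt (by linarith)
  exact (hball hd).le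

/-- **Uniform set-to-set decay of `𝒢(a)` from ONE exponential moment of `∂P∂*`.**  For every
`d`, `a > 0`, reference rate `κ₀ > 0` and moment bound `m` there is a rate `κ ∈ (0, κ₀]` —
chosen BEFORE `n = L^k`, the torus `M`, the source set `T` and the test vectors, i.e. depending
on `(d, a, κ₀, m)` only — such that: whenever the row defect of `∂P∂*` at rate `κ₀` for the
weight `ρ_T = η·dist_∞(·,T)` is `≤ m` (the (1.126)-type INPUT, a hypothesis), then for `v`
supported on `T × {1..d}` and `u` supported at sup distance `≥ nR` from `T`,
`|⟨u, 𝒢(a)v⟩| ≤ (2/γ(d,a))·e^{−κR}·‖u‖‖v‖`.  This is the quantifier shape of the printed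
«δ₀ > 0 depending on d only» of Prop. 1.2, in L²-form, conditional on the moment input.
[cite: Balaban1984PropagatorsI, Prop. 1.2 (1.110) p.35 (quantifier shape; L²-form shadow, ours)] -/
theorem calG_setDecay_uniform (d : ℕ) (a : ℝ) (ha : 0 < a) {κ₀ : ℝ} (hκ₀ : 0 < κ₀) (m : ℝ) :
    ∃ κ : ℝ, 0 < κ ∧ κ ≤ κ₀ ∧
      ∀ (n : ℕ) [NeZero n] (M : Fin d → ℕ) [∀ μ, NeZero (M μ)] (hn : 1 ≤ n)
        (_h2 : ∀ μ, 2 ≤ fine n M μ) (T : Finset (Tor (fine n M))) (hT : T.Nonempty)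
        (_hPm : ∀ e, ctRowDefect
          (GradOp (fine n M) (n : ℂ) * PcT n M (n : ℂ) * (GradOp (fine n M) (n : ℂ))ᴴ) κ₀
            (rhoT T hT (1 / n)) e ≤ m)
        (R : ℝ) (u v : Tor (fine n M) × Fin d → ℂ)
        (_hv : ∀ e, v e ≠ 0 → e.1 ∈ T)
        (_hu : ∀ e, u e ≠ 0 → ∀ t ∈ T, (n : ℝ) * R ≤ ldist (fine n M) e.1 t),
        ‖star u ⬝ᵥ (calG n hn M a ha *ᵥ v)‖
          ≤ 2 / gammaA d a * Real.exp (-(κ * R)) * (Real.sqrt (nsq u) * Real.sqrt (nsq v)) := by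
  obtain ⟨κ, hκ, hκle, hbud⟩ := exists_rate d a hκ₀ m
  refine ⟨κ, hκ, hκle, ?_⟩
  intro n _ M _ hn h2 T hT hPm R u v hv hu
  have hγ := gammaA_pos (d := d) (a := a)
  -- the moment at rate κ₀ bounds J_P at rate κ by (κ/κ₀)²·m
  have hP : ∀ e, ctRowDefect
      (GradOp (fine n M) (n : ℂ) * PcT n M (n : ℂ) * (GradOp (fine n M) (n : ℂ))ᴴ) κ
        (rhoT T hT (1 / n)) e ≤ (κ / κ₀) ^ 2 * m := fun e =>
    (ctRowDefect_le_rate_sq _ _ hκ₀ hκ.le hκle e).trans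
      (mul_le_mul_of_nonneg_left (hPm e) (sq_nonneg _))
  have hm : defectBudget d a κ (2 * ((d : ℝ) + 1)) + (κ / κ₀) ^ 2 * m < gammaA d a := by
    linarith
  have h := calG_setDecay n M hn a ha h2 T hT hκ.le hP hm hv hu
  refine h.trans ?_
  have hden : gammaA d a / 2
      ≤ gammaA d a - (defectBudget d a κ (2 * ((d : ℝ) + 1)) + (κ / κ₀) ^ 2 * m) := by linarith
  have hnn : 0 ≤ Real.sqrt (nsq u) * Real.sqrt (nsq v) := by positivity
  calc Real.exp (-(κ * R))
        / (gammaA d a - (defectBudget d a κ (2 * ((d : ℝ) + 1)) + (κ / κ₀) ^ 2 * m))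
        * (Real.sqrt (nsq u) * Real.sqrt (nsq v))
      ≤ Real.exp (-(κ * R)) / (gammaA d a / 2) * (Real.sqrt (nsq u) * Real.sqrt (nsq v)) :=
        mul_le_mul_of_nonneg_right
          (div_le_div_of_nonneg_left (Real.exp_pos _).le (by positivity) hden) hnn
    _ = 2 / gammaA d a * Real.exp (-(κ * R)) * (Real.sqrt (nsq u) * Real.sqrt (nsq v)) := by
        field_simp

end Uniform

end Literature.MathematicalPhysics.QuantumFieldTheory.Balaban1983to89.Beta.DeltaACombesThomasSets
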